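import Summits.BirchSwinnertonDyer.BirchSwinnertonDyer.Theorems.MordellShaFreeCutThreeAdicLinks
import Summits.BirchSwinnertonDyer.BirchSwinnertonDyer.Theorems.CongruentShaFreeCutTwoAdicSelmerFinite

/-! # Route `MordellShaFreeCut` (rung S2b) — crux `AnalyticRankOneOfRankOneFiniteShaThree`
(stmt-BirchSwinnertonDyer-19160): Link A `ThreeAdicControlOfRankOne` (anticyclotomic control for the
`j = 0` curves at the ADDITIVE prime `3`) holds modulo Poitou–Tate and the local Euler characteristic

Cell `bsd-cn100`, prover seat `bsd-cn100-s2-c3` g3 (filed for the S2b hand `bsd-cn100-s2b-c3` as the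
twin of the S2 result). Supports, does not close, stmt-BirchSwinnertonDyer-19160.
HONEST FRAMING: CONDITIONAL on the two TEXTBOOK named facts `poitouTate_sum_localTatePairing_eq_zero K`
(Milne ADT I Thm. 4.10(b) with Cor. 2.3) and `localEulerPoincareCharacteristic (K_v)` (Milne ADT I
Thm. 2.8); nothing about crux B of S2b, the Sylvester leaf or any case of BSD is proved; the crux's
research content is Link B `ThreeAdicCharValueEqHeegnerLogSq`.

## What is proved

The typer's Link A for S2b (`MordellShaFreeCutThreeAdicLinks.ThreeAdicControlOfRankOne`, p424081):
for every elliptic, globally minimal `W/ℚ` with `j = 0`, an imaginary quadratic `K` with the Heegner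
hypothesis for `N(W)` and for `3`, `v̄ ∋ 3`, an anticyclotomic `ℤ₃`-extension `κ` with generator `γ`,
`rank W(K) = 1` and `#Ш(W/K)[3^∞] < ∞`: `∃ m, AcSelmer.XAc.HasCharValuationAt (W_K) 3 κ v̄ ∅ γ m`. The
GENERIC kernel theorems of `CongruentShaFreeCutTwoAdicControlOfSelmerFinite` (p429171: Castella's
`Sel_𝔭(K, E[p^∞])` finite ⟹ `Sel^γ` finite ⟹ `HasCharValuationAt`, for ANY `p`, no hypothesis at the
strict place) and `CongruentShaFreeCutTwoAdicSelmerFinite` (p429679: `Sel_𝔭(K, E[p^∞])` finite at a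
rank-one datum for ANY `p`, no `Irr`, no `Mult`) apply verbatim at `p = 3` (the hypothesis `j = 0` is
not even used):

* **`threeAdicControlOfRankOne_of_poitouTate_of_localEulerChar`** — Link A of S2b modulo the two
  textbook facts;
* **`cruxB_of_linkB`** — `AnalyticRankOneOfRankOneFiniteShaThree` from Link B
  `ThreeAdicCharValueEqHeegnerLogSq` + `3`-parity, modularity, Hoffstein–Luo, Kato, Gross 1984,
  GZ+Kolyvagin + the two textbook facts (`cruxB_of_threeAdicLinks` with hA discharged).

[cite: GreenbergLNM1716, §3 Lemma 3.3, p. 90; §4 Lemma 4.2] [cite: JetchevSkinnerWan2017, Prop. 3.2.1 and §3.3]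
[cite: MilneADT2006, Ch. I, Thm. 4.10(b) and Thm. 2.8] [cite: Castella2018, Def. 2.2, Thm. 2.3 (arXiv:1704.06608 p. 5) (shape)] -/

noncomputable section

open scoped Classical

namespace Summit.BirchSwinnertonDyer.BirchSwinnertonDyer.Theorems.MordellShaFreeCutThreeAdicControlOfSelmerFinite

open WeierstrassCurve NumberField IsDedekindDomain Field Literature.NumberTheory.EllipticCurves
open Literature.NumberTheory.GaloisRepresentations Literature.NumberTheory.GaloisCohomology
open Summit.BirchSwinnertonDyer.Rank1Residual.X11b
open Summit.BirchSwinnertonDyer.Rank1Residual.X11b.AcSelmer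
open Summit.BirchSwinnertonDyer.BirchSwinnertonDyer.Theorems.MordellShaFreeCutThreeAdicLinks
open Summit.BirchSwinnertonDyer.BirchSwinnertonDyer.Theorems.CongruentShaFreeCutTwoAdicControlOfSelmerFinite
open Summit.BirchSwinnertonDyer.BirchSwinnertonDyer.Theorems.CongruentShaFreeCutTwoAdicSelmerFinite

/-- **Link A `ThreeAdicControlOfRankOne` of S2b holds, granted Poitou–Tate global duality (`hPT`,
Milne ADT I Thm. 4.10(b)/Cor. 2.3) and Tate's local Euler–Poincaré characteristic (`hEP`, Milne ADT I
Thm. 2.8).** At a datum (`W/ℚ` elliptic, globally minimal; `K` imaginary quadratic, Heegner hypothesis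
for `3` ⟹ `3` splits; `v̄ ∋ 3`; `rank W(K) = 1`, `#Ш(W/K)[3^∞] < ∞`): `Sel_{v̄}(K, W[3^∞])` is finite by
`finite_selmerAcBase_of_rankOne W 3`, and `hasCharValuationAt_of_finite_selmerAcBase W 3` gives the
conclusion (strict-place snake lemma with no torsion hypothesis — `W(ℚ)[3]` may be non-trivial for
`j = 0` — Greenberg Lemma 3.3, Nakayama, Greenberg's criterion, all from the b2b X11b sub-tree). The
hypothesis `j = 0` is not used. [cite: MilneADT2006, Ch. I, Thm. 4.10(b) and Thm. 2.8]
[cite: JetchevSkinnerWan2017, Prop. 3.2.1 and §3.3] [cite: GreenbergLNM1716, §3 Lemma 3.3, p. 90; §4 Lemma 4.2] -/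
theorem threeAdicControlOfRankOne_of_poitouTate_of_localEulerChar
    (hPT : ∀ (K : Type) [Field K] [NumberField K], poitouTate_sum_localTatePairing_eq_zero K)
    (hEP : ∀ (K : Type) [Field K] [NumberField K] (v : HeightOneSpectrum (𝓞 K)),
      localEulerPoincareCharacteristic (v.adicCompletion K)) :
    ThreeAdicControlOfRankOne := by
  intro W _ _ _hj K _ _ N _ _hN hK _hHN hH3 ι v vbar _hv hvbar _hne κ hκ γ _ hrank hsha
  have hsplit : SplitsIn K 3 := hH3 3 Fact.out (dvd_refl 3)
  haveI : Finite (selmerAcBase (W.baseChange K) 3 vbar ∅) :=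
    finite_selmerAcBase_of_rankOne W 3 K (hPT K) (hEP K) hK hsplit hrank hsha vbar hvbar
  exact hasCharValuationAt_of_finite_selmerAcBase W 3 hK hsplit κ hκ γ vbar hvbar

/-- **Crux B of S2b `AnalyticRankOneOfRankOneFiniteShaThree` from LINK B and named facts only**:
`3`-parity (`hpar`), modularity (`hmod`), Hoffstein–Luo (`hHL`), Kato (`hKato`), Heegner points exist
(`hHP`), Gross–Zagier + Kolyvagin over `K` (`hGZ`), Poitou–Tate (`hPT`), local Euler characteristic
(`hEP`), and the OPEN Link B `ThreeAdicCharValueEqHeegnerLogSq` (`hB`): `cruxB_of_threeAdicLinks`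
(p424081) with Link A DISCHARGED by `threeAdicControlOfRankOne_of_poitouTate_of_localEulerChar`.
CONDITIONAL; credits nothing. [cite: CastellaGrossiLeeSkinner2022, §5.2 (proof of Thm. 5.2.1)]
[cite: GrossZagier1986, Thm. I.6.3 with V.§2] [cite: MilneADT2006, Ch. I, Thm. 4.10(b) and Thm. 2.8] -/
theorem cruxB_of_linkB
    (hpar : ∀ (W : WeierstrassCurve ℚ) [W.IsElliptic] (p : ℕ) [Fact p.Prime], p_parity W p)
    (hmod : ModularForms.exists_isNewformOf) (hHL : HoffsteinLuo1997_exists_twist_L_one_ne_zero)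
    (hKato : ∀ (W : WeierstrassCurve ℚ) [W.IsElliptic] (p : ℕ) [Fact p.Prime],
      kato_finite_of_L_one_ne_zero W p)
    (hHP : ∀ (W : WeierstrassCurve ℚ) (K : Type) [Field K] [NumberField K],
      exists_isHeegnerPoint W K)
    (hGZ : ∀ (W : WeierstrassCurve ℚ) (N : ℕ) [NeZero N] (K : Type) [Field K] [NumberField K],
      analyticRankEK_eq_one_iff_heegner_nonTorsion W N K)
    (hPT : ∀ (K : Type) [Field K] [NumberField K], poitouTate_sum_localTatePairing_eq_zero K)
    (hEP : ∀ (K : Type) [Field K] [NumberField K] (v : HeightOneSpectrum (𝓞 K)),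
      localEulerPoincareCharacteristic (v.adicCompletion K))
    (hB : ThreeAdicCharValueEqHeegnerLogSq) :
    Summit.BirchSwinnertonDyer.BirchSwinnertonDyer.Theses.MordellShaFreeCut.AnalyticRankOneOfRankOneFiniteShaThree :=
  cruxB_of_threeAdicLinks hpar hmod hHL hKato hHP hGZ
    (threeAdicControlOfRankOne_of_poitouTate_of_localEulerChar hPT hEP) hB

end Summit.BirchSwinnertonDyer.BirchSwinnertonDyer.Theorems.MordellShaFreeCutThreeAdicControlOfSelmerFinite

end
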